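import Mathlib
import HarnessLib
import Literature.Probability.MarkovChains.MarkovChainDecomposition
import Literature.Probability.MarkovChains.LogSobolevConstant

/-!
# The logarithmic Sobolev constant of a decomposable Markov chain: `α ≥ min{ᾱ/3, ᾱα_min/(3γ + ᾱ)}` (Jerrum–Son–Tetali–Vigoda 2004, Theorem 4)

HONEST FRAMING: exact (Metropolis-corrected) sampling algorithms for lattice gauge theory; figures
of merit are autocorrelation/cost numbers at stated couplings and volumes; no continuum-physics claim.

Conventions of `MarkovChainDecomposition.lean` (namespace `…MarkovChains.Decomposition`: `block`,
`blockMass π blk = π̄`, `blockLaw π blk i = π_i` (a law on `Ω` supported on `Ω_i`), `blockAvg`,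
`projectionChain = P̄`, `restrictionChain = P_i`, `blockFlow = π̄(i)P̄(i,j)`, `crossTerm = C_ij`,
`escapeProb`, `escapeParameter = γ`, `lawVariance_decomposition` (4), `dirichletForm_decomposition` (5),
`blockFlow_mul_sq_sub_le` (7)–(13), `sum_escape_term_le` / `sum_entry_term_le` (13)–(15)) and of
`LogSobolevConstant.lean` (`entForm π f = 𝓛_π(f) = Σ π f² log(f²/‖f‖²_π)` — JSTV's (23)
`L_π(f) = E_π[f²(ln f² − ln E_π f²)]` —, `logSobolevConst`, `Saloffcoste1997_lemma_2_2_2` `2α ≤ λ`).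

SOURCE: M. Jerrum, J.-B. Son, P. Tetali, E. Vigoda, *Elementary bounds on Poincaré and log-Sobolev
constants for decomposable Markov chains*, Ann. Appl. Probab. **14** (2004) 1741–1765
[JerrumEtAl2004] = arXiv:math/0503537, §3 "Log-Sobolev constant via decomposition" (arXiv pp. 9–12):
eq. (23) `L_π(f) := E_π[f²(ln f² − ln(E_π f²))]`; "A log-Sobolev inequality is an inequality of the form
`𝓔(f,f) ≥ αL(f)`"; **THEOREM 4.** "The setting is exactly as in Theorem 1. Suppose the projection chain
satisfies a log-Sobolev inequality with constant `ᾱ` and that the restriction chains satisfy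
inequalities with uniform constant `α_min`. Then the original Markov chain satisfies a log-Sobolev
inequality with constant `α := min{ᾱ/3, ᾱα_min/(3γ + ᾱ)}`."  PROOF as printed: the entropy
decomposition (25) `L(f) = Σ_i π̄(i)L_i(f) + Σ_i π̄(i)(E_i f²)(ln(E_i f²) − ln(E f²))` ("the second
term expresses the entropy between blocks", i.e. `L_π̄(√(E_i f²))`); (26) the restriction inequalities
for the first term; (27)–(28) the projection inequality and the three-term bound
`(√(E_if²) − √(E_jf²))² ≤ 3[(√(E_if²) − √(Ê^j_if²))² + (√(Ê^j_if²) − √(Ê^i_jf²))² + (√(Ê^i_jf²) −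
√(E_jf²))²]`; (29)–(30) `Σ₂ ≤ Σ_{i≠j} C_ij` by "Jensen's inequality applied to the convex function
`g(α,β) := (√α − √β)²`"; (31)–(35) `Σ₁ = Σ₃ ≤ 2γ Σ_i π̄(i)Var_{π_i} f ≤ (2γ/λ_min) Σ π̄(i)𝓔_i ≤
(γ/α_min) Σ π̄(i)𝓔_i`, "(35) applies the general inequality `λ ≥ 2α`" — "[Strictly speaking, we must
interpret `λ_min` here as the minimum over the optimal Poincaré constants (i.e., spectral gaps) of the
`m` restriction Markov chains.]"; (36)–(37) `L(f) ≤ (3/(2ᾱ))Σ_{i≠j}C_ij + ((3γ + ᾱ)/(ᾱα_min))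
Σ π̄(i)𝓔_i(f,f)`, compared with (5).

## Content (everything PROVED; 0 named facts)
* §1 NONNEGATIVE WEIGHTS.  The block laws `π_i` vanish off `Ω_i`, so the positivity hypotheses of
  `LogSobolevConstant.lean` are relaxed here: `entForm_nonneg_of_nonneg` (`𝓛_μ(f) ≥ 0` for `μ ≥ 0`,
  `Σ μ = 1`, via `log y ≥ 1 − 1/y`), `entForm_one_add_smul_ge_of_nonneg` (the quantitative expansion of
  Lemma 2.2.2 for `μ ≥ 0`, same proof) and **`poincare_of_logSobolev`: a log-Sobolev inequality
  `c𝓛_μ ≤ 𝓔` implies the Poincaré inequality `2c·Var_μ ≤ 𝓔`** — the "general inequality `λ ≥ 2α`" of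
  (35) in the form the proof consumes.
* §2 `blockSqMean π blk f i = E_{π_i} f²`; **eq. (25)** `entForm_decomposition`:
  `𝓛_π(f) = Σ_i π̄(i)𝓛_{π_i}(f) + 𝓛_π̄(i ↦ √(E_{π_i}f²))`.
* §3 The between-block term: `sq_abs_sub_sqrt_le` (`E_μ(|f| − √(E_μf²))² ≤ 2Var_μ f`) and
  **`projection_entForm_le`**: `ᾱ·𝓛_π̄(√(E_if²)) ≤ (3/2)Σ_{i≠j}C_ij + 6γ Σ_i π̄(i)Var_{π_i} f`
  (= (28) with (30) and (33)).  DECLARED DEVIATION: instead of the intermediate laws `π̂^j_i` and the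
  Jensen step (29)/(31), the three-term bound is taken with the tree's `blockFlow_mul_sq_sub_le` applied
  to `|f|` at the constants `√(E_if²)`, `√(E_jf²)`; its middle term is `Σ π(x)P(x,y)(|f(x)| − |f(y)|)² ≤
  C_ij` and its outer terms are bounded by `γπ̄(i)E_{π_i}(|f| − √(E_if²))² ≤ 2γπ̄(i)Var_{π_i} f` — the
  same constants `Σ₂ ≤ ΣC_ij`, `Σ₁ = Σ₃ ≤ 2γΣπ̄(i)Var_{π_i}f` as (30), (33).
* §4 **THEOREM 4** `JerrumEtAl2004_thm_4_poincare` (with an explicit Poincaré constant `λ_min` of the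
  restriction chains alongside `α_min`: `α ≥ min{ᾱ/3, ᾱα_minλ_min/(6γα_min + ᾱλ_min)}`, which is the
  printed bound before (35) is applied), **`JerrumEtAl2004_thm_4`** (the printed constant
  `min{ᾱ/3, ᾱα_min/(3γ + ᾱ)}` from `α_min` alone, via `poincare_of_logSobolev`), and
  `JerrumEtAl2004_thm_4_escapeParameter` (with `γ` = eq. (3)).
NOT CLAIMED: the paper's remarks after Theorem 4 (the `(1 − ε)` refinement), §4 examples, Corollary 5.

Context (cell pub-lqcd; value-free): with `StateDecomposition.lean` / `MarkovChainDecomposition.lean`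
(spectral gaps of multimodal chains from pieces) this gives the ENTROPY constant of a pieced chain —
the input `α` of `Miclo1997_cor_7_tvDist_log`, whose mixing estimate carries `log log(1/π_min)`.
-/

noncomputable section

namespace Literature.Probability.MarkovChains

open Finset Matrix Filter Topology

/-! ## §1 The entropy form and the log-Sobolev ⇒ Poincaré step for NONNEGATIVE weights -/

section Nonneg

variable {X : Type*} [Fintype X]

/-- `𝓛_μ(f) ≥ 0` for a nonnegative probability vector `μ` (zero weights allowed): termwise
`f² log(f²/A) ≥ f² − A` (`log y ≥ 1 − 1/y`), summed against `μ` (`A = ‖f‖²_μ`). [cite: JerrumEtAl2004,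
§3 eq. (23) (the entropy-like quantity `L_π(f)`, for the block laws `π_i`)] [cite: Saloffcoste1997,
§2.2.1 ("Observe that `𝓛(f)` is nonnegative")] -/
theorem entForm_nonneg_of_nonneg {μ : X → ℝ} (hμ : ∀ x, 0 ≤ μ x) (hμ1 : ∑ x, μ x = 1) (f : X → ℝ) :
    0 ≤ entForm μ f := by
  unfold entForm
  set A := piInner μ f f with hA
  have hA0 : 0 ≤ A := piInner_self_nonneg hμ f
  have hAeq : ∑ x, μ x * f x ^ 2 = A := by
    rw [hA]; unfold piInner; exact sum_congr rfl fun x _ => by ring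
  rcases hA0.eq_or_lt with hA0' | hApos
  · have hz : ∀ x, μ x * f x ^ 2 = 0 := fun x =>
      (sum_eq_zero_iff_of_nonneg fun x _ => mul_nonneg (hμ x) (sq_nonneg _)).1
        (hAeq.trans hA0'.symm) x (mem_univ x)
    exact sum_nonneg fun x _ => by rw [← mul_assoc, hz x, zero_mul]
  · have hterm : ∀ x, f x ^ 2 - A ≤ f x ^ 2 * Real.log (f x ^ 2 / A) := by
      intro x
      by_cases hf : f x = 0
      · simp [hf, hApos.le]
      · have hf2 : 0 < f x ^ 2 := by positivity
        have h := Real.one_sub_inv_le_log_of_pos (div_pos hf2 hApos)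
        have e : 1 - (f x ^ 2 / A)⁻¹ = (f x ^ 2 - A) / f x ^ 2 := by
          field_simp
        rw [e, div_le_iff₀ hf2] at h
        linarith
    calc (0 : ℝ) = ∑ x, μ x * (f x ^ 2 - A) := by
          rw [show ∑ x, μ x * (f x ^ 2 - A) = ∑ x, μ x * f x ^ 2 - A * ∑ x, μ x by
            rw [mul_sum, ← sum_sub_distrib]; exact sum_congr rfl fun x _ => by ring]
          rw [hAeq, hμ1, mul_one, sub_self]
      _ ≤ _ := sum_le_sum fun x _ => mul_le_mul_of_nonneg_left (hterm x) (hμ x)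

/-- The quantitative expansion `𝓛(1 + εg) ≥ 2ε²(1 − Bε)²/(1 + ε²)` of Lemma 2.2.2 for a NONNEGATIVE
probability vector (the proof of `entForm_one_add_smul_ge` verbatim; positivity of the weights is not
used). [cite: Saloffcoste1997, §2.2.1 Lemma 2.2.2 (proof: "`𝓛(f) = 2ε² Var(g) + O(ε³)`")] -/
theorem entForm_one_add_smul_ge_of_nonneg {π : X → ℝ} (hπ : ∀ x, 0 ≤ π x) (hπ1 : ∑ x, π x = 1)
    {g : X → ℝ} (hg0 : ∑ x, π x * g x = 0) (hg1 : piInner π g g = 1) {B : ℝ} (hB : 1 ≤ B)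
    (hgB : ∀ x, |g x| ≤ B) {ε : ℝ} (hε : 0 < ε) (hεB : ε ≤ 1 / (4 * B)) :
    2 * ε ^ 2 * (1 - B * ε) ^ 2 / (1 + ε ^ 2) ≤ entForm π (fun x => 1 + ε * g x) := by
  have hB0 : 0 < B := lt_of_lt_of_le one_pos hB
  have hBε : B * ε ≤ 1 / 4 := by
    have h := mul_le_mul_of_nonneg_left hεB hB0.le
    have e : B * (1 / (4 * B)) = 1 / 4 := by field_simp
    linarith
  have hg2 : ∑ x, π x * g x ^ 2 = 1 := by
    rw [← hg1]; unfold piInner; exact sum_congr rfl fun x _ => by ring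
  have hgx : ∀ x, -B ≤ g x ∧ g x ≤ B := fun x => abs_le.1 (hgB x)
  -- `A = ‖f‖²_π = 1 + ε²`
  set A : ℝ := 1 + ε ^ 2 with hA
  have hA0 : 0 < A := by positivity
  have hA1 : 1 ≤ A := by rw [hA]; nlinarith
  have hAf : piInner π (fun x => 1 + ε * g x) (fun x => 1 + ε * g x) = A := by
    unfold piInner
    have e : ∀ x, π x * ((1 + ε * g x) * (1 + ε * g x))
        = π x + 2 * ε * (π x * g x) + ε ^ 2 * (π x * g x ^ 2) := fun x => by ring
    simp_rw [e]
    rw [sum_add_distrib, sum_add_distrib, ← mul_sum, ← mul_sum, hπ1, hg0, hg2, hA]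
    ring
  -- `q = 2g + ε(g² − 1)`, `d = εq/A`, `f² = A(1 + d)`
  set q : X → ℝ := fun x => 2 * g x + ε * (g x ^ 2 - 1) with hq
  set d : X → ℝ := fun x => ε * q x / A with hd
  have hfd : ∀ x, (1 + ε * g x) ^ 2 = A * (1 + d x) := by
    intro x
    simp only [hd, hq]
    field_simp
    ring
  have hqB : ∀ x, |q x| ≤ 3 * B := by
    intro x
    obtain ⟨h1, h2⟩ := hgx x
    have hsq : g x ^ 2 ≤ B ^ 2 := by nlinarith
    have hεle : ε ≤ B / 4 := by
      calc ε ≤ 1 / (4 * B) := hεB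
        _ ≤ B / 4 := by
          rw [div_le_div_iff₀ (by positivity) (by norm_num)]
          nlinarith
    rw [abs_le]
    constructor
    · simp only [hq]; nlinarith
    · simp only [hq]; nlinarith
  have hdB : ∀ x, |d x| ≤ 3 * B * ε := by
    intro x
    simp only [hd]
    rw [abs_div, abs_mul, abs_of_pos hε, abs_of_pos hA0]
    calc ε * |q x| / A ≤ ε * |q x| / 1 :=
          div_le_div_of_nonneg_left (mul_nonneg hε.le (abs_nonneg _)) one_pos hA1
      _ ≤ 3 * B * ε := by rw [div_one]; nlinarith [hqB x, abs_nonneg (q x)]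
  have hpos : ∀ x, 0 < 1 + d x := by
    intro x
    have h34 : |d x| ≤ 3 / 4 := (hdB x).trans (by nlinarith)
    linarith [(abs_le.1 h34).1]
  -- `Σ π d = 0`, `Σ π d² ≥ ε²(4 − 4Bε)/A²`, `Σ π d³ ≤ 3Bε Σ π d²`
  have hS1 : ∑ x, π x * d x = 0 := by
    have e : ∀ x, π x * d x
        = (ε / A) * (2 * (π x * g x) + ε * (π x * g x ^ 2) - ε * π x) := fun x => by
      simp only [hd, hq]; field_simp; ring
    simp_rw [e]
    rw [← mul_sum, sum_sub_distrib, sum_add_distrib, ← mul_sum, ← mul_sum, ← mul_sum, hg0, hg2, hπ1]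
    ring
  have hS2 : ε ^ 2 * (4 - 4 * B * ε) / A ^ 2 ≤ ∑ x, π x * d x ^ 2 := by
    -- `Σ π q² ≥ 4 + 4ε Σ π g³ ≥ 4 − 4Bε`
    have hq2 : ∀ x, 4 * g x ^ 2 + 4 * ε * (g x ^ 3 - g x) ≤ q x ^ 2 := by
      intro x
      simp only [hq]
      nlinarith [sq_nonneg (ε * (g x ^ 2 - 1))]
    have hg3 : ∀ x, -B * g x ^ 2 ≤ g x ^ 3 := by
      intro x
      have := (hgx x).1
      nlinarith [sq_nonneg (g x)]
    have hsum : 4 - 4 * B * ε ≤ ∑ x, π x * q x ^ 2 := by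
      calc 4 - 4 * B * ε = ∑ x, (4 * (π x * g x ^ 2) + 4 * ε * (-B * (π x * g x ^ 2) - π x * g x)) := by
            rw [sum_add_distrib, ← mul_sum, ← mul_sum, sum_sub_distrib, ← mul_sum, hg2, hg0]; ring
        _ ≤ ∑ x, π x * q x ^ 2 := sum_le_sum fun x _ => by
            have h1 := mul_le_mul_of_nonneg_left (hq2 x) (hπ x)
            have h2 := mul_le_mul_of_nonneg_left (hg3 x) (hπ x)
            nlinarith [h1, h2, (hπ x), hε.le]
    have e : ∑ x, π x * d x ^ 2 = ε ^ 2 / A ^ 2 * ∑ x, π x * q x ^ 2 := by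
      rw [mul_sum]
      refine sum_congr rfl fun x _ => ?_
      simp only [hd]
      field_simp
    rw [e]
    have hε2 : 0 ≤ ε ^ 2 / A ^ 2 := by positivity
    calc ε ^ 2 * (4 - 4 * B * ε) / A ^ 2 = ε ^ 2 / A ^ 2 * (4 - 4 * B * ε) := by ring
      _ ≤ ε ^ 2 / A ^ 2 * ∑ x, π x * q x ^ 2 := mul_le_mul_of_nonneg_left hsum hε2
  have hS3 : ∑ x, π x * d x ^ 3 ≤ 3 * B * ε * ∑ x, π x * d x ^ 2 := by
    rw [mul_sum]
    refine sum_le_sum fun x _ => ?_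
    have h1 : d x ≤ |d x| := le_abs_self _
    have h2 : d x ^ 3 ≤ 3 * B * ε * d x ^ 2 := by
      have hd2 : 0 ≤ d x ^ 2 := sq_nonneg _
      nlinarith [hdB x, h1, hd2]
    nlinarith [h2, (hπ x)]
  -- `𝓛(f) = A Σ π (1 + d) log(1 + d)`
  have hL : entForm π (fun x => 1 + ε * g x) = A * ∑ x, π x * ((1 + d x) * Real.log (1 + d x)) := by
    unfold entForm
    rw [hAf, mul_sum]
    refine sum_congr rfl fun x _ => ?_
    simp only
    rw [hfd x, mul_div_cancel_left₀ _ hA0.ne']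
    ring
  -- Taylor to third order, termwise
  have hT : ∑ x, π x * (d x + d x ^ 2 / 2 - d x ^ 3 / 6)
      ≤ ∑ x, π x * ((1 + d x) * Real.log (1 + d x)) := by
    refine sum_le_sum fun x _ => mul_le_mul_of_nonneg_left ?_ (hπ x)
    have h := mul_log_ge_taylor3 (hpos x)
    rwa [add_sub_cancel_left] at h
  have hT' : ∑ x, π x * (d x + d x ^ 2 / 2 - d x ^ 3 / 6)
      = (∑ x, π x * d x ^ 2) / 2 - (∑ x, π x * d x ^ 3) / 6 := by
    have e : ∀ x, π x * (d x + d x ^ 2 / 2 - d x ^ 3 / 6)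
        = π x * d x + (π x * d x ^ 2) / 2 - (π x * d x ^ 3) / 6 := fun x => by ring
    simp_rw [e]
    rw [sum_sub_distrib, sum_add_distrib, hS1, ← sum_div, ← sum_div]
    ring
  -- assemble
  have hD2 : 0 ≤ ∑ x, π x * d x ^ 2 := sum_nonneg fun x _ => mul_nonneg (hπ x) (sq_nonneg _)
  have h1Bε : 0 ≤ 1 - B * ε := by linarith
  have hmain : 2 * ε ^ 2 * (1 - B * ε) ^ 2 / A ^ 2
      ≤ ∑ x, π x * ((1 + d x) * Real.log (1 + d x)) := by
    calc 2 * ε ^ 2 * (1 - B * ε) ^ 2 / A ^ 2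
        = (1 - B * ε) / 2 * (ε ^ 2 * (4 - 4 * B * ε) / A ^ 2) := by ring
      _ ≤ (1 - B * ε) / 2 * ∑ x, π x * d x ^ 2 :=
          mul_le_mul_of_nonneg_left hS2 (by linarith)
      _ = (∑ x, π x * d x ^ 2) / 2 - (3 * B * ε * ∑ x, π x * d x ^ 2) / 6 := by ring
      _ ≤ (∑ x, π x * d x ^ 2) / 2 - (∑ x, π x * d x ^ 3) / 6 := by linarith [hS3]
      _ = ∑ x, π x * (d x + d x ^ 2 / 2 - d x ^ 3 / 6) := hT'.symm
      _ ≤ _ := hT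
  rw [hL]
  calc 2 * ε ^ 2 * (1 - B * ε) ^ 2 / (1 + ε ^ 2)
      = A * (2 * ε ^ 2 * (1 - B * ε) ^ 2 / A ^ 2) := by rw [← hA]; field_simp
    _ ≤ A * ∑ x, π x * ((1 + d x) * Real.log (1 + d x)) := mul_le_mul_of_nonneg_left hmain hA0.le

/-- **"The general inequality `λ ≥ 2α`" in Poincaré form, for nonnegative weights**: if
`c·𝓛_μ(f) ≤ 𝓔_K(f)` for every `f` (`μ ≥ 0` a probability vector, `K ≥ 0`), then
`2c·Var_μ(f) ≤ 𝓔_K(f)` for every `f` (normalise `g = (f − E f)/√Var f`, apply the hypothesis to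
`1 + εg`, use `𝓔(1 + εg) = ε²𝓔(g)` and the expansion, let `ε → 0`). [cite: JerrumEtAl2004, §3
eq. (35) ("applies the general inequality `λ ≥ 2α` … that relates Poincaré and log-Sobolev constants")]
[cite: Saloffcoste1997, §2.2.1 Lemma 2.2.2] -/
theorem poincare_of_logSobolev {μ : X → ℝ} (hμ : ∀ x, 0 ≤ μ x) (hμ1 : ∑ x, μ x = 1)
    {K : Matrix X X ℝ} (hK : ∀ x y, 0 ≤ K x y) {c : ℝ}
    (hc : ∀ f : X → ℝ, c * entForm μ f ≤ dirichletForm μ K f) (f : X → ℝ) :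
    2 * c * lawVariance μ f ≤ dirichletForm μ K f := by
  have hE0 : 0 ≤ dirichletForm μ K f := dirichletForm_nonneg hμ hK f
  have hV0 : 0 ≤ lawVariance μ f := lawVariance_nonneg hμ f
  by_cases hc0 : c ≤ 0
  · exact (mul_nonpos_of_nonpos_of_nonneg (by linarith) hV0).trans hE0
  push Not at hc0
  rcases hV0.eq_or_lt with hV | hV
  · rw [← hV, mul_zero]; exact hE0
  -- normalise
  set m := lawMean μ f with hm
  set V := lawVariance μ f with hV_eq
  set s := Real.sqrt V with hs
  have hs0 : 0 < s := Real.sqrt_pos.2 hV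
  have hs2 : s ^ 2 = V := Real.sq_sqrt hV.le
  set g : X → ℝ := fun x => s⁻¹ * (f x - m) with hg
  have hg0 : ∑ x, μ x * g x = 0 := by
    have h := sum_mul_sub_lawMean hμ1 f
    simp only [hg]
    rw [show ∑ x, μ x * (s⁻¹ * (f x - m)) = s⁻¹ * ∑ x, μ x * (f x - lawMean μ f) by
      rw [mul_sum]; exact sum_congr rfl fun x _ => by ring, h, mul_zero]
  have hg1 : piInner μ g g = 1 := by
    have h := piInner_centred_eq_lawVariance μ f
    unfold piInner at h ⊢
    simp only [hg]
    rw [show ∑ x, μ x * (s⁻¹ * (f x - m) * (s⁻¹ * (f x - m)))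
        = s⁻¹ ^ 2 * ∑ x, μ x * ((f x - lawMean μ f) * (f x - lawMean μ f)) by
      rw [mul_sum]; exact sum_congr rfl fun x _ => by ring, h, ← hV_eq, ← hs2, inv_pow,
      inv_mul_cancel₀ (pow_ne_zero 2 hs0.ne')]
  have hEg : dirichletForm μ K g = s⁻¹ ^ 2 * dirichletForm μ K f := by
    simp only [hg]
    rw [dirichletForm_smul, dirichletForm_sub_const]
  -- a uniform bound `|g| ≤ B`
  set B : ℝ := 1 + ∑ x, |g x| with hB
  have hB1 : 1 ≤ B := by
    have : 0 ≤ ∑ x, |g x| := sum_nonneg fun x _ => abs_nonneg _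
    linarith
  have hgB : ∀ x, |g x| ≤ B := fun x => by
    have h := single_le_sum (f := fun x => |g x|) (fun x _ => abs_nonneg (g x)) (mem_univ x)
    linarith
  have hB0 : 0 < B := lt_of_lt_of_le one_pos hB1
  set φ : ℝ → ℝ := fun ε => c * (2 * (1 - B * ε) ^ 2 / (1 + ε ^ 2)) with hφ
  have key : ∀ ε : ℝ, 0 < ε → ε ≤ 1 / (4 * B) → φ ε ≤ dirichletForm μ K g := by
    intro ε hε hεB
    have h1 := hc (fun x => 1 + ε * g x)
    rw [dirichletForm_one_add_smul] at h1
    have h2 := entForm_one_add_smul_ge_of_nonneg hμ hμ1 hg0 hg1 hB1 hgB hε hεB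
    have h3 : c * (2 * ε ^ 2 * (1 - B * ε) ^ 2 / (1 + ε ^ 2)) ≤ ε ^ 2 * dirichletForm μ K g :=
      (mul_le_mul_of_nonneg_left h2 hc0.le).trans h1
    have hε2 : 0 < ε ^ 2 := by positivity
    have e : c * (2 * ε ^ 2 * (1 - B * ε) ^ 2 / (1 + ε ^ 2)) = ε ^ 2 * φ ε := by
      simp only [hφ]; ring
    rw [e] at h3
    exact le_of_mul_le_mul_left h3 hε2
  have hcont : Continuous φ := by
    have hden : ∀ ε : ℝ, 1 + ε ^ 2 ≠ 0 := fun ε => by positivity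
    exact continuous_const.mul ((continuous_const.mul ((continuous_const.sub
      (continuous_const.mul continuous_id)).pow 2)).div (continuous_const.add (continuous_id.pow 2))
      hden)
  have hφ0 : φ 0 = 2 * c := by simp only [hφ]; ring
  have hlim : Tendsto φ (𝓝[>] 0) (𝓝 (2 * c)) := by
    rw [← hφ0]
    exact (hcont.tendsto 0).mono_left nhdsWithin_le_nhds
  have hev : ∀ᶠ ε in 𝓝[>] (0 : ℝ), φ ε ≤ dirichletForm μ K g := by
    have h4B : (0 : ℝ) < 1 / (4 * B) := by positivity
    filter_upwards [Ioo_mem_nhdsGT h4B] with ε hε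
    exact key ε hε.1 hε.2.le
  have h2c : 2 * c ≤ dirichletForm μ K g := le_of_tendsto hlim hev
  -- undo the normalisation: `𝓔(g) = 𝓔(f)/V`
  rw [hEg, inv_pow, hs2] at h2c
  have h := mul_le_mul_of_nonneg_right h2c hV.le
  have e : V⁻¹ * dirichletForm μ K f * V = dirichletForm μ K f := by
    field_simp
  rw [e] at h
  linarith

end Nonneg

/-! ## §2 The entropy decomposition (25) -/

namespace Decomposition

variable {X I : Type*} [Fintype X] [Fintype I] [DecidableEq I]

/-- `E_{π_i} f² = Σ_x π_i(x) f(x)²`, the second moment of `f` in block `i` (`= ‖f‖²_{π_i}`).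
[cite: JerrumEtAl2004, §3 eq. (25) (the quantities `E_i f²`)] -/
def blockSqMean (π : X → ℝ) (blk : X → I) (f : X → ℝ) (i : I) : ℝ :=
  piInner (blockLaw π blk i) f f

omit [Fintype I] in
/-- `E_{π_i} f² = π̄(i)⁻¹ Σ_{x ∈ Ω_i} π(x)f(x)²`. [cite: JerrumEtAl2004, §3 eq. (25)] -/
theorem blockSqMean_eq (π : X → ℝ) (blk : X → I) (f : X → ℝ) (i : I) :
    blockSqMean π blk f i = (∑ x ∈ block blk i, π x * f x ^ 2) / blockMass π blk i := by
  unfold blockSqMean piInner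
  rw [sum_blockLaw_mul]
  congr 1
  exact sum_congr rfl fun x _ => by ring

omit [Fintype I] in
/-- `E_{π_i} f² ≥ 0` for `π ≥ 0`. [cite: JerrumEtAl2004, §3 eq. (25)] -/
theorem blockSqMean_nonneg {π : X → ℝ} (hπ : ∀ x, 0 ≤ π x) (blk : X → I) (f : X → ℝ) (i : I) :
    0 ≤ blockSqMean π blk f i :=
  piInner_self_nonneg (blockLaw_nonneg hπ blk i) f

omit [Fintype I] in
/-- `π̄(i)·E_{π_i} f² = Σ_{x ∈ Ω_i} π(x)f(x)²`. [cite: JerrumEtAl2004, §3 eq. (25)] -/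
theorem blockMass_mul_blockSqMean {π : X → ℝ} {blk : X → I} {i : I} (hM : blockMass π blk i ≠ 0)
    (f : X → ℝ) : blockMass π blk i * blockSqMean π blk f i = ∑ x ∈ block blk i, π x * f x ^ 2 := by
  rw [blockSqMean_eq, mul_div_cancel₀ _ hM]

/-- `E_π f² = Σ_i π̄(i)E_{π_i} f²` (so `‖(√(E_{π_i}f²))_i‖²_π̄ = ‖f‖²_π`). [cite: JerrumEtAl2004, §3
eq. (25) (with eq. (4))] -/
theorem piInner_self_eq_sum_blockSqMean {π : X → ℝ} {blk : X → I} (hM : ∀ i, blockMass π blk i ≠ 0)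
    (f : X → ℝ) : piInner π f f = ∑ i, blockMass π blk i * blockSqMean π blk f i := by
  unfold piInner
  rw [sum_eq_sum_block blk]
  refine sum_congr rfl fun i _ => ?_
  rw [blockMass_mul_blockSqMean (hM i)]
  exact sum_congr rfl fun x _ => by ring

/-- **Eq. (25): the decomposition of the entropy with respect to the partition**,
`L_π(f) = Σ_i π̄(i)L_{π_i}(f) + Σ_i π̄(i)(E_if²)(ln(E_if²) − ln(E f²))`, the second sum being
`L_π̄(√(E_{π_i}f²))` ("the first term expresses the entropy within blocks of the partition and the
second term expresses the entropy between blocks"; `π > 0`, nonempty blocks).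
[cite: JerrumEtAl2004, §3 eq. (25)] -/
theorem entForm_decomposition {π : X → ℝ} (hπ : ∀ x, 0 < π x) {blk : X → I}
    (hblk : Function.Surjective blk) (f : X → ℝ) :
    entForm π f = ∑ i, blockMass π blk i * entForm (blockLaw π blk i) f
      + entForm (blockMass π blk) (fun i => Real.sqrt (blockSqMean π blk f i)) := by
  have hM : ∀ i, blockMass π blk i ≠ 0 := fun i => (blockMass_pos hπ hblk i).ne'
  have hπ0 : ∀ x, 0 ≤ π x := fun x => (hπ x).le
  set n : I → ℝ := fun i => blockSqMean π blk f i with hn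
  have hn0 : ∀ i, 0 ≤ n i := fun i => blockSqMean_nonneg hπ0 blk f i
  set N : ℝ := piInner π f f with hNdf
  have hN : N = ∑ i, blockMass π blk i * n i := piInner_self_eq_sum_blockSqMean hM f
  have hNr : piInner (blockMass π blk) (fun i => Real.sqrt (n i)) (fun i => Real.sqrt (n i)) = N := by
    rw [hN]; unfold piInner
    exact sum_congr rfl fun i _ => by rw [Real.mul_self_sqrt (hn0 i)]
  -- positivity where `f ≠ 0`
  have hnpos : ∀ x, f x ≠ 0 → 0 < n (blk x) := by
    intro x hf
    have h1 : π x * f x ^ 2 ≤ blockMass π blk (blk x) * n (blk x) := by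
      rw [hn]
      simp only
      rw [blockMass_mul_blockSqMean (hM _)]
      exact single_le_sum (f := fun y => π y * f y ^ 2) (fun y _ => mul_nonneg (hπ0 y) (sq_nonneg _))
        (mem_block.2 rfl)
    have h2 : 0 < π x * f x ^ 2 := mul_pos (hπ x) (by positivity)
    have h3 : 0 < blockMass π blk (blk x) := blockMass_pos hπ hblk _
    nlinarith
  have hNpos : ∀ x, f x ≠ 0 → 0 < N := by
    intro x hf
    have h1 : π x * (f x * f x) ≤ N := by
      rw [hNdf]; unfold piInner
      exact single_le_sum (f := fun y => π y * (f y * f y)) (fun y _ => mul_nonneg (hπ0 y) (mul_self_nonneg _))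
        (mem_univ x)
    nlinarith [mul_pos (hπ x) (mul_self_pos.2 hf)]
  -- termwise split of the logarithm
  have hterm : ∀ x, f x ^ 2 * Real.log (f x ^ 2 / N)
      = f x ^ 2 * Real.log (f x ^ 2 / n (blk x)) + f x ^ 2 * Real.log (n (blk x) / N) := by
    intro x
    by_cases hf : f x = 0
    · simp [hf]
    · have hnb : n (blk x) ≠ 0 := (hnpos x hf).ne'
      have hNb : N ≠ 0 := (hNpos x hf).ne'
      have hf2 : f x ^ 2 ≠ 0 := pow_ne_zero 2 hf
      rw [← mul_add, ← Real.log_mul (div_ne_zero hf2 hnb) (div_ne_zero hnb hNb)]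
      congr 1
      rw [show f x ^ 2 / n (blk x) * (n (blk x) / N) = f x ^ 2 / N by field_simp]
  -- the three entropy forms as explicit sums
  have hL : entForm π f = ∑ i, ∑ x ∈ block blk i, π x * (f x ^ 2 * Real.log (f x ^ 2 / N)) := by
    unfold entForm
    rw [← hNdf]
    exact sum_eq_sum_block blk _
  have hR1 : ∀ i, blockMass π blk i * entForm (blockLaw π blk i) f
      = ∑ x ∈ block blk i, π x * (f x ^ 2 * Real.log (f x ^ 2 / n i)) := by
    intro i
    unfold entForm
    rw [show piInner (blockLaw π blk i) f f = n i from rfl, sum_blockLaw_mul, mul_div_cancel₀ _ (hM i)]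
  have hR2 : entForm (blockMass π blk) (fun i => Real.sqrt (n i))
      = ∑ i, blockMass π blk i * (n i * Real.log (n i / N)) := by
    unfold entForm
    rw [hNr]
    exact sum_congr rfl fun i _ => by rw [Real.sq_sqrt (hn0 i)]
  rw [hL, hR2, ← sum_add_distrib]
  refine sum_congr rfl fun i _ => ?_
  rw [hR1 i]
  calc ∑ x ∈ block blk i, π x * (f x ^ 2 * Real.log (f x ^ 2 / N))
      = ∑ x ∈ block blk i, (π x * (f x ^ 2 * Real.log (f x ^ 2 / n i))
          + Real.log (n i / N) * (π x * f x ^ 2)) := by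
        refine sum_congr rfl fun x hx => ?_
        rw [hterm x, mem_block.1 hx]; ring
    _ = _ := by
        rw [sum_add_distrib, ← mul_sum, ← blockMass_mul_blockSqMean (hM i)]
        simp only [hn]
        ring

/-! ## §3 The between-block entropy: (27)–(36) -/

omit [Fintype I] [DecidableEq I] in
/-- `E_μ(|f| − √(E_μf²))² ≤ 2Var_μ f` for a nonnegative probability vector `μ` (expand:
`E(|f| − s)² = 2s(s − E|f|)` with `s = √(Ef²) ≥ E|f|`, and `2Var f ≥ 2(Ef² − (E|f|)²) = 2(s − E|f|)(s +
E|f|)`).  This is how the outer terms of the three-term bound are controlled here (in place of the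
intermediate laws `π̂^j_i` of (31)–(32)); the resulting constant `2γ` is that of (33).
[cite: JerrumEtAl2004, §3 eqs. (31)–(33)] -/
theorem sum_mul_sq_abs_sub_sqrt_le {μ : X → ℝ} (hμ : ∀ x, 0 ≤ μ x) (hμ1 : ∑ x, μ x = 1) (f : X → ℝ) :
    ∑ x, μ x * (|f x| - Real.sqrt (∑ y, μ y * f y ^ 2)) ^ 2 ≤ 2 * lawVariance μ f := by
  set S := ∑ y, μ y * f y ^ 2 with hS
  have hS0 : 0 ≤ S := sum_nonneg fun y _ => mul_nonneg (hμ y) (sq_nonneg _)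
  set s := Real.sqrt S with hs
  have hs0 : 0 ≤ s := Real.sqrt_nonneg _
  have hs2 : s ^ 2 = S := Real.sq_sqrt hS0
  set a := ∑ x, μ x * |f x| with ha
  set m := lawMean μ f with hm
  have ha0 : 0 ≤ a := sum_nonneg fun x _ => mul_nonneg (hμ x) (abs_nonneg _)
  -- `|E f| ≤ E|f| ≤ √(E f²)`
  have hma : |m| ≤ a := by
    rw [hm]; unfold lawMean
    exact (abs_sum_le_sum_abs _ _).trans (le_of_eq (sum_congr rfl fun x _ => by
      rw [abs_mul, abs_of_nonneg (hμ x)]))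
  have has : a ^ 2 ≤ S := by
    -- Cauchy–Schwarz: `(Σ μ|f|)² ≤ (Σ μ)(Σ μ f²)`
    have h := sum_mul_sq_le_sq_mul_sq univ (fun x => Real.sqrt (μ x)) (fun x => Real.sqrt (μ x) * |f x|)
    have e1 : ∑ x, Real.sqrt (μ x) * (Real.sqrt (μ x) * |f x|) = a :=
      sum_congr rfl fun x _ => by rw [← mul_assoc, Real.mul_self_sqrt (hμ x)]
    have e2 : ∑ x, Real.sqrt (μ x) ^ 2 = 1 := by
      rw [← hμ1]; exact sum_congr rfl fun x _ => Real.sq_sqrt (hμ x)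
    have e3 : ∑ x, (Real.sqrt (μ x) * |f x|) ^ 2 = S :=
      sum_congr rfl fun x _ => by rw [mul_pow, Real.sq_sqrt (hμ x), sq_abs]
    rw [e1, e2, e3, one_mul] at h
    exact h
  have hsa : a ≤ s := by
    rw [← Real.sqrt_sq ha0, hs]
    exact Real.sqrt_le_sqrt has
  -- expand the left side
  have hL : ∑ x, μ x * (|f x| - s) ^ 2 = 2 * s * (s - a) := by
    have e : ∀ x, μ x * (|f x| - s) ^ 2 = μ x * f x ^ 2 - 2 * s * (μ x * |f x|) + s ^ 2 * μ x :=
      fun x => by rw [sub_sq, sq_abs]; ring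
    simp_rw [e]
    rw [sum_add_distrib, sum_sub_distrib, ← mul_sum, ← mul_sum, ← hS, ← ha, hμ1, ← hs2]
    ring
  have hV : lawVariance μ f = S - m ^ 2 := by
    unfold lawVariance
    have e : ∀ x, μ x * (f x - lawMean μ f) ^ 2
        = μ x * f x ^ 2 - 2 * lawMean μ f * (μ x * f x) + lawMean μ f ^ 2 * μ x := fun x => by ring
    simp_rw [e]
    rw [sum_add_distrib, sum_sub_distrib, ← mul_sum, ← mul_sum, ← hS, hμ1, ← hm]
    unfold lawMean at hm
    rw [← hm]
    ring
  rw [hL, hV]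
  have hm2 : m ^ 2 ≤ a ^ 2 := by
    rw [← sq_abs m]
    exact pow_le_pow_left₀ (abs_nonneg m) hma 2
  nlinarith [hsa, ha0, hs0, hm2]

omit [Fintype I] in
/-- `Σ_{x∈Ω_i,y∈Ω_j} π(x)P(x,y)(|f(x)| − |f(y)|)² ≤ C_ij` (`||a| − |b|| ≤ |a − b|`) — the bound
`Σ₂ ≤ Σ C_ij` of (29)–(30). [cite: JerrumEtAl2004, §3 eqs. (29)–(30)] -/
theorem crossTerm_abs_le {π : X → ℝ} (hπ : ∀ x, 0 ≤ π x) {P : Matrix X X ℝ} (hP0 : ∀ x y, 0 ≤ P x y)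
    (blk : X → I) (f : X → ℝ) (i j : I) :
    crossTerm π P blk (fun x => |f x|) i j ≤ crossTerm π P blk f i j := by
  unfold crossTerm
  refine sum_le_sum fun x _ => sum_le_sum fun y _ => mul_le_mul_of_nonneg_left ?_
    (mul_nonneg (hπ x) (hP0 x y))
  have h := abs_abs_sub_abs_le_abs_sub (f x) (f y)
  calc (|f x| - |f y|) ^ 2 = |(|f x| - |f y|)| ^ 2 := (sq_abs _).symm
    _ ≤ |f x - f y| ^ 2 := pow_le_pow_left₀ (abs_nonneg _) h 2
    _ = (f x - f y) ^ 2 := sq_abs _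

/-- **The outer terms, (31)–(33)**: `Σ_i Σ_{j≠i} Σ_{x∈Ω_i,y∈Ω_j} π(x)P(x,y)(|f(x)| − √(E_if²))²
≤ γ Σ_i π̄(i)E_{π_i}(|f| − √(E_if²))² ≤ 2γ Σ_i π̄(i)Var_{π_i} f`. [cite: JerrumEtAl2004, §3
eqs. (31)–(33) (`Σ₁ ≤ 2γ Σ_i π̄(i) Var_{π_i} f`)] -/
theorem sum_escape_sqrt_term_le {π : X → ℝ} (hπ : ∀ x, 0 ≤ π x) {P : Matrix X X ℝ}
    (hP0 : ∀ x y, 0 ≤ P x y) {blk : X → I} (hM : ∀ i, blockMass π blk i ≠ 0) {γ : ℝ}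
    (hγ : ∀ x, escapeProb P blk x ≤ γ) (f : X → ℝ) :
    ∑ i, ∑ j ∈ univ.erase i, ∑ x ∈ block blk i, ∑ y ∈ block blk j,
        π x * P x y * (|f x| - Real.sqrt (blockSqMean π blk f i)) ^ 2
      ≤ 2 * γ * ∑ i, blockMass π blk i * lawVariance (blockLaw π blk i) f := by
  rcases isEmpty_or_nonempty I with hI | ⟨⟨i₀⟩⟩
  · simp
  obtain ⟨x₀, -⟩ : (block blk i₀).Nonempty := by
    rcases (block blk i₀).eq_empty_or_nonempty with h | h
    · exact absurd (by unfold blockMass; rw [h, sum_empty]) (hM i₀)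
    · exact h
  have hγ0 : 0 ≤ γ := (escapeProb_nonneg hP0 blk x₀).trans (hγ x₀)
  rw [mul_sum]
  refine sum_le_sum fun i _ => ?_
  set s := Real.sqrt (blockSqMean π blk f i) with hs
  -- inner: `Σ_{j≠i} Σ_x Σ_y … = Σ_{x∈Ω_i} π(x)(|f x| − s)² · escapeProb(x) ≤ γ Σ_{x∈Ω_i} π(x)(|f x| − s)²`
  rw [sum_comm]
  have h1 : ∀ x ∈ block blk i, ∑ j ∈ univ.erase i, ∑ y ∈ block blk j, π x * P x y * (|f x| - s) ^ 2
      ≤ γ * (π x * (|f x| - s) ^ 2) := by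
    intro x hx
    have hxi : blk x = i := mem_block.mp hx
    have e : ∑ j ∈ univ.erase i, ∑ y ∈ block blk j, π x * P x y * (|f x| - s) ^ 2
        = π x * (|f x| - s) ^ 2 * escapeProb P blk x := by
      unfold escapeProb
      rw [← hxi, mul_sum, ← sum_erase_sum_block blk x]
      exact sum_congr rfl fun j _ => sum_congr rfl fun y _ => by ring
    rw [e]
    have h0 : 0 ≤ π x * (|f x| - s) ^ 2 := mul_nonneg (hπ x) (sq_nonneg _)
    nlinarith [hγ x]
  refine (sum_le_sum h1).trans ?_
  rw [← mul_sum]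
  -- `Σ_{x∈Ω_i} π(x)(|f x| − s)² = π̄(i) E_{π_i}(|f| − s)² ≤ π̄(i)·2Var_{π_i} f`
  have h2 : ∑ x ∈ block blk i, π x * (|f x| - s) ^ 2
      = blockMass π blk i * ∑ x, blockLaw π blk i x * (|f x| - s) ^ 2 := by
    rw [sum_blockLaw_mul, mul_div_cancel₀ _ (hM i)]
  have h3 : ∑ x, blockLaw π blk i x * (|f x| - s) ^ 2 ≤ 2 * lawVariance (blockLaw π blk i) f := by
    have h := sum_mul_sq_abs_sub_sqrt_le (blockLaw_nonneg hπ blk i) (sum_blockLaw (hM i)) f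
    have e : ∑ y, blockLaw π blk i y * f y ^ 2 = blockSqMean π blk f i := by
      unfold blockSqMean piInner; exact sum_congr rfl fun y _ => by ring
    rw [e, ← hs] at h
    exact h
  rw [h2]
  have hMi : 0 ≤ blockMass π blk i := blockMass_nonneg hπ blk i
  have h4 := mul_le_mul_of_nonneg_left h3 (mul_nonneg hγ0 hMi)
  linarith

/-- The entry-side outer terms (the time reversal of (31)–(33)), for a `π`-reversible `P`:
`Σ_i Σ_{j≠i} Σ_{x∈Ω_i,y∈Ω_j} π(x)P(x,y)(|f(y)| − √(E_jf²))² ≤ 2γ Σ_j π̄(j)Var_{π_j} f`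
("`Σ₁` (which equals `Σ₃` by time-reversibility)"). [cite: JerrumEtAl2004, §3 (the sentence before
eq. (31))] -/
theorem sum_entry_sqrt_term_le {π : X → ℝ} (hπ : ∀ x, 0 ≤ π x) {P : Matrix X X ℝ}
    (hP0 : ∀ x y, 0 ≤ P x y) (hDB : DetailedBalance π P) {blk : X → I}
    (hM : ∀ i, blockMass π blk i ≠ 0) {γ : ℝ} (hγ : ∀ x, escapeProb P blk x ≤ γ) (f : X → ℝ) :
    ∑ i, ∑ j ∈ univ.erase i, ∑ x ∈ block blk i, ∑ y ∈ block blk j,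
        π x * P x y * (|f y| - Real.sqrt (blockSqMean π blk f j)) ^ 2
      ≤ 2 * γ * ∑ i, blockMass π blk i * lawVariance (blockLaw π blk i) f := by
  have h : ∑ i, ∑ j ∈ univ.erase i, ∑ x ∈ block blk i, ∑ y ∈ block blk j,
        π x * P x y * (|f y| - Real.sqrt (blockSqMean π blk f j)) ^ 2
      = ∑ j, ∑ i ∈ univ.erase j, ∑ y ∈ block blk j, ∑ x ∈ block blk i,
        π y * P y x * (|f y| - Real.sqrt (blockSqMean π blk f j)) ^ 2 := by
    rw [sum_erase_comm]
    refine sum_congr rfl fun j _ => sum_congr rfl fun i _ => ?_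
    rw [sum_comm]
    exact sum_congr rfl fun y _ => sum_congr rfl fun x _ => by rw [hDB x y]
  rw [h]
  exact sum_escape_sqrt_term_le hπ hP0 hM hγ f

/-- **Eqs. (27)–(36): the between-block entropy.**  If the projection chain satisfies
`ᾱ·𝓛_π̄(g) ≤ 𝓔_π̄(g)` for all `g` and every escape probability is `≤ γ`, then
`ᾱ·𝓛_π̄(√(E_{π_i}f²)) ≤ (3/2)Σ_{i≠j}C_ij + 6γ Σ_i π̄(i)Var_{π_i} f` (`π > 0` reversible for `P ≥ 0`,
nonempty blocks): the log-Sobolev inequality of `P̄` at `g = √(E_if²)`, the three-term bound, `Σ₂ ≤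
ΣC_ij` and `Σ₁ = Σ₃ ≤ 2γΣπ̄(i)Var_{π_i}f`. [cite: JerrumEtAl2004, §3 eqs. (27)–(33)] -/
theorem projection_entForm_le [DecidableEq X] {π : X → ℝ} (hπ : ∀ x, 0 < π x)
    {P : Matrix X X ℝ} (hP0 : ∀ x y, 0 ≤ P x y) (hDB : DetailedBalance π P) {blk : X → I}
    (hblk : Function.Surjective blk) {alphaP : ℝ}
    (hproj : ∀ g : I → ℝ, alphaP * entForm (blockMass π blk) g
      ≤ dirichletForm (blockMass π blk) (projectionChain π P blk) g)
    {γ : ℝ} (hγ : ∀ x, escapeProb P blk x ≤ γ) (f : X → ℝ) :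
    alphaP * entForm (blockMass π blk) (fun i => Real.sqrt (blockSqMean π blk f i))
      ≤ (3 / 2) * ∑ i, ∑ j ∈ univ.erase i, crossTerm π P blk f i j
        + 6 * γ * ∑ i, blockMass π blk i * lawVariance (blockLaw π blk i) f := by
  have hM : ∀ i, blockMass π blk i ≠ 0 := fun i => (blockMass_pos hπ hblk i).ne'
  have hπ0 : ∀ x, 0 ≤ π x := fun x => (hπ x).le
  have h1 := hproj (fun i => Real.sqrt (blockSqMean π blk f i))
  rw [dirichletForm_projectionChain hM] at h1
  -- three-term bound with `|f|` at the constants `√(E_if²)`, `√(E_jf²)`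
  have h2 : ∑ i, ∑ j ∈ univ.erase i, blockFlow π P blk i j
        * (Real.sqrt (blockSqMean π blk f i) - Real.sqrt (blockSqMean π blk f j)) ^ 2
      ≤ ∑ i, ∑ j ∈ univ.erase i, 3 *
        ((∑ x ∈ block blk i, ∑ y ∈ block blk j,
            π x * P x y * (|f x| - Real.sqrt (blockSqMean π blk f i)) ^ 2)
          + crossTerm π P blk (fun x => |f x|) i j
          + ∑ x ∈ block blk i, ∑ y ∈ block blk j,
            π x * P x y * (|f y| - Real.sqrt (blockSqMean π blk f j)) ^ 2) :=
    sum_le_sum fun i _ => sum_le_sum fun j _ =>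
      blockFlow_mul_sq_sub_le hπ0 hP0 blk (fun x => |f x|) i j _ _
  have h3 := sum_escape_sqrt_term_le hπ0 hP0 hM hγ f
  have h4 := sum_entry_sqrt_term_le hπ0 hP0 hDB hM hγ f
  have h5 : ∑ i, ∑ j ∈ univ.erase i, crossTerm π P blk (fun x => |f x|) i j
      ≤ ∑ i, ∑ j ∈ univ.erase i, crossTerm π P blk f i j :=
    sum_le_sum fun i _ => sum_le_sum fun j _ => crossTerm_abs_le hπ0 hP0 blk f i j
  simp_rw [mul_add, sum_add_distrib, ← mul_sum] at h2
  linarith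

/-! ## §4 Theorem 4 -/

/-- **THEOREM 4, two-parameter form (the bound of (37) before (35) is invoked).**  In the setting of
Theorem 1 (`π > 0` reversible for `P ≥ 0`, nonempty blocks, escape probabilities `≤ γ`, `γ ≥ 0`),
suppose `ᾱ𝓛_π̄ ≤ 𝓔_π̄` (`ᾱ > 0`), and the restriction chains satisfy `α_min𝓛_{π_i} ≤ 𝓔_{π_i}`
(`α_min > 0`) AND the Poincaré inequalities `λ_min Var_{π_i} ≤ 𝓔_{π_i}` (`λ_min > 0`).  Then
`min{ᾱ/3, ᾱα_minλ_min/(6γα_min + ᾱλ_min)}·𝓛_π(f) ≤ 𝓔_π(f)` for every `f`.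
[cite: JerrumEtAl2004, §3 Theorem 4 (proof, eqs. (25)–(37) with (34) in place of (35))] -/
theorem JerrumEtAl2004_thm_4_poincare [DecidableEq X] {π : X → ℝ} (hπ : ∀ x, 0 < π x)
    {P : Matrix X X ℝ} (hP0 : ∀ x y, 0 ≤ P x y) (hDB : DetailedBalance π P) {blk : X → I}
    (hblk : Function.Surjective blk) {alphaP alphaMin lamMin γ : ℝ} (halphaP : 0 < alphaP)
    (halphaMin : 0 < alphaMin) (hlamMin : 0 < lamMin) (hγ0 : 0 ≤ γ)
    (hproj : ∀ g : I → ℝ, alphaP * entForm (blockMass π blk) g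
      ≤ dirichletForm (blockMass π blk) (projectionChain π P blk) g)
    (hres : ∀ i, ∀ f : X → ℝ, alphaMin * entForm (blockLaw π blk i) f
      ≤ dirichletForm (blockLaw π blk i) (restrictionChain P blk) f)
    (hresP : ∀ i, ∀ f : X → ℝ, lamMin * lawVariance (blockLaw π blk i) f
      ≤ dirichletForm (blockLaw π blk i) (restrictionChain P blk) f)
    (hγ : ∀ x, escapeProb P blk x ≤ γ) (f : X → ℝ) :
    min (alphaP / 3) (alphaP * alphaMin * lamMin / (6 * γ * alphaMin + alphaP * lamMin))
      * entForm π f ≤ dirichletForm π P f := by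
  have hM : ∀ i, blockMass π blk i ≠ 0 := fun i => (blockMass_pos hπ hblk i).ne'
  have hπ0 : ∀ x, 0 ≤ π x := fun x => (hπ x).le
  -- aggregates
  set A := ∑ i, blockMass π blk i * entForm (blockLaw π blk i) f with hA
  set B := entForm (blockMass π blk) (fun i => Real.sqrt (blockSqMean π blk f i)) with hB
  set V := ∑ i, blockMass π blk i * lawVariance (blockLaw π blk i) f with hV
  set L := ∑ i, blockMass π blk i * dirichletForm (blockLaw π blk i) (restrictionChain P blk) f
    with hL
  set Cx := ∑ i, ∑ j ∈ univ.erase i, crossTerm π P blk f i j with hCx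
  have h25 : entForm π f = A + B := entForm_decomposition hπ hblk f
  have h5 : dirichletForm π P f = L + (1 / 2) * Cx := dirichletForm_decomposition hM P f
  -- (26): α_min A ≤ L ; Poincaré: λ_min V ≤ L
  have h26 : alphaMin * A ≤ L := by
    rw [hA, hL, mul_sum]
    refine sum_le_sum fun i _ => ?_
    rw [mul_left_comm]
    exact mul_le_mul_of_nonneg_left (hres i f) (blockMass_nonneg hπ0 blk i)
  have h34 : lamMin * V ≤ L := by
    rw [hV, hL, mul_sum]
    refine sum_le_sum fun i _ => ?_
    rw [mul_left_comm]
    exact mul_le_mul_of_nonneg_left (hresP i f) (blockMass_nonneg hπ0 blk i)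
  -- (27)–(33): ᾱ B ≤ (3/2) Cx + 6γ V
  have h36 : alphaP * B ≤ (3 / 2) * Cx + 6 * γ * V := projection_entForm_le hπ hP0 hDB hblk hproj hγ f
  have hA0 : 0 ≤ A := sum_nonneg fun i _ => mul_nonneg (blockMass_nonneg hπ0 blk i)
    (entForm_nonneg_of_nonneg (blockLaw_nonneg hπ0 blk i) (sum_blockLaw (hM i)) f)
  have hV0 : 0 ≤ V := sum_nonneg fun i _ =>
    mul_nonneg (blockMass_nonneg hπ0 blk i) (lawVariance_nonneg (blockLaw_nonneg hπ0 blk i) f)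
  have hCx0 : 0 ≤ Cx := sum_nonneg fun i _ => sum_nonneg fun j _ => crossTerm_nonneg hπ0 hP0 blk f i j
  -- the constant
  set μ := 6 * γ * alphaMin + alphaP * lamMin with hμ
  have hμpos : 0 < μ := by rw [hμ]; nlinarith
  set al := min (alphaP / 3) (alphaP * alphaMin * lamMin / μ) with hal
  have hal1 : al ≤ alphaP / 3 := min_le_left _ _
  have hal2 : al * μ ≤ alphaP * alphaMin * lamMin := (le_div_iff₀ hμpos).mp (min_le_right _ _)
  have hal0 : 0 ≤ al := le_min (by linarith)
    (div_nonneg (mul_nonneg (mul_nonneg halphaP.le halphaMin.le) hlamMin.le) hμpos.le)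
  rw [h25, h5]
  -- multiply the goal by `ᾱ α_min λ_min > 0` and assemble (a linear combination of the pieces)
  have hL0 : 0 ≤ L := (mul_nonneg hlamMin.le hV0).trans h34
  have hML : 0 ≤ alphaMin * lamMin := mul_nonneg halphaMin.le hlamMin.le
  have K1 : alphaMin * lamMin * (al * (alphaP * B))
      ≤ alphaMin * lamMin * (al * ((3 / 2) * Cx + 6 * γ * V)) :=
    mul_le_mul_of_nonneg_left (mul_le_mul_of_nonneg_left h36 hal0) hML
  have K2 : (3 / 2) * (alphaMin * lamMin) * (al * Cx)
      ≤ (3 / 2) * (alphaMin * lamMin) * ((alphaP / 3) * Cx) :=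
    mul_le_mul_of_nonneg_left (mul_le_mul_of_nonneg_right hal1 hCx0) (by positivity)
  have K3 : 6 * γ * alphaMin * al * (lamMin * V) ≤ 6 * γ * alphaMin * al * L :=
    mul_le_mul_of_nonneg_left h34 (by positivity)
  have K4 : al * alphaP * lamMin * (alphaMin * A) ≤ al * alphaP * lamMin * L :=
    mul_le_mul_of_nonneg_left h26 (by positivity)
  have K5 : al * μ * L ≤ alphaP * alphaMin * lamMin * L := mul_le_mul_of_nonneg_right hal2 hL0
  have key : alphaP * alphaMin * lamMin * (al * (A + B))
      ≤ alphaP * alphaMin * lamMin * (L + 1 / 2 * Cx) := by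
    rw [hμ] at K5
    linarith
  exact le_of_mul_le_mul_left key (by positivity)

/-- **THEOREM 4 (Jerrum–Son–Tetali–Vigoda 2004), as printed.**  Consider a finite-state time-reversible
Markov chain (`π > 0`, `P ≥ 0`, `π(x)P(x,y) = π(y)P(y,x)`) decomposed into a projection chain `P̄` and
restriction chains `P_i` along a partition into nonempty blocks, every one-step escape probability
being `≤ γ` (`γ ≥ 0`; e.g. `γ` of eq. (3)).  Suppose the projection chain satisfies a log-Sobolev
inequality with constant `ᾱ > 0` (`𝓔_π̄(g,g) ≥ ᾱL_π̄(g)`) and the restriction chains satisfy log-Sobolev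
inequalities with uniform constant `α_min > 0` (`𝓔_{π_i}(f,f) ≥ α_min L_{π_i}(f)`).  Then the original
chain satisfies a log-Sobolev inequality with constant **`α := min{ᾱ/3, ᾱα_min/(3γ + ᾱ)}`**:
`𝓔_π(f,f) ≥ α L_π(f)` for every `f` (the Poincaré constant `λ_min ≥ 2α_min` of the restriction chains
supplied by `poincare_of_logSobolev`, as in (35)). [cite: JerrumEtAl2004, §3 Theorem 4 (with proof,
eqs. (25)–(37))] -/
theorem JerrumEtAl2004_thm_4 [DecidableEq X] {π : X → ℝ} (hπ : ∀ x, 0 < π x)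
    {P : Matrix X X ℝ} (hP : IsRowStochastic P) (hDB : DetailedBalance π P) {blk : X → I}
    (hblk : Function.Surjective blk) {alphaP alphaMin γ : ℝ} (halphaP : 0 < alphaP)
    (halphaMin : 0 < alphaMin) (hγ0 : 0 ≤ γ)
    (hproj : ∀ g : I → ℝ, alphaP * entForm (blockMass π blk) g
      ≤ dirichletForm (blockMass π blk) (projectionChain π P blk) g)
    (hres : ∀ i, ∀ f : X → ℝ, alphaMin * entForm (blockLaw π blk i) f
      ≤ dirichletForm (blockLaw π blk i) (restrictionChain P blk) f)
    (hγ : ∀ x, escapeProb P blk x ≤ γ) (f : X → ℝ) :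
    min (alphaP / 3) (alphaP * alphaMin / (3 * γ + alphaP)) * entForm π f ≤ dirichletForm π P f := by
  have hM : ∀ i, blockMass π blk i ≠ 0 := fun i => (blockMass_pos hπ hblk i).ne'
  have hπ0 : ∀ x, 0 ≤ π x := fun x => (hπ x).le
  have hR : IsRowStochastic (restrictionChain P blk) := restrictionChain_isRowStochastic hP blk
  -- (35): the restriction chains satisfy Poincaré inequalities with constant `2α_min`
  have hresP : ∀ i, ∀ f : X → ℝ, 2 * alphaMin * lawVariance (blockLaw π blk i) f
      ≤ dirichletForm (blockLaw π blk i) (restrictionChain P blk) f := fun i f =>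
    poincare_of_logSobolev (blockLaw_nonneg hπ0 blk i) (sum_blockLaw (hM i)) hR.1 (hres i) f
  have h := JerrumEtAl2004_thm_4_poincare hπ hP.1 hDB hblk halphaP halphaMin
    (by linarith : 0 < 2 * alphaMin) hγ0 hproj hres hresP hγ f
  have e : alphaP * alphaMin * (2 * alphaMin) / (6 * γ * alphaMin + alphaP * (2 * alphaMin))
      = alphaP * alphaMin / (3 * γ + alphaP) := by
    have h1 : (3 * γ + alphaP) ≠ 0 := by linarith
    have h2 : alphaMin ≠ 0 := halphaMin.ne'
    field_simp
    ring
  rwa [e] at h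

/-- **Theorem 4 with the printed parameter `γ` of eq. (3)** (`escapeParameter`, the maximal one-step
escape probability). [cite: JerrumEtAl2004, §3 Theorem 4 with §2 eq. (3)] -/
theorem JerrumEtAl2004_thm_4_escapeParameter [DecidableEq X] {π : X → ℝ} (hπ : ∀ x, 0 < π x)
    {P : Matrix X X ℝ} (hP : IsRowStochastic P) (hDB : DetailedBalance π P) {blk : X → I}
    (hblk : Function.Surjective blk) {alphaP alphaMin : ℝ} (halphaP : 0 < alphaP)
    (halphaMin : 0 < alphaMin)
    (hproj : ∀ g : I → ℝ, alphaP * entForm (blockMass π blk) g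
      ≤ dirichletForm (blockMass π blk) (projectionChain π P blk) g)
    (hres : ∀ i, ∀ f : X → ℝ, alphaMin * entForm (blockLaw π blk i) f
      ≤ dirichletForm (blockLaw π blk i) (restrictionChain P blk) f) (f : X → ℝ) :
    min (alphaP / 3) (alphaP * alphaMin / (3 * escapeParameter P blk + alphaP)) * entForm π f
      ≤ dirichletForm π P f :=
  JerrumEtAl2004_thm_4 hπ hP hDB hblk halphaP halphaMin (escapeParameter_nonneg hP.1 blk) hproj hres
    (escapeProb_le_escapeParameter P blk) f

/-- **Theorem 4 for the logarithmic Sobolev CONSTANTS**: with `ᾱ = logSobolevConst π̄ P̄ > 0` and a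
uniform bound `0 < α_min ≤ α(P_i)` in the sense `α_min𝓛_{π_i} ≤ 𝓔_{π_i}`, the chain's constant obeys
`α(P) ≥ min{ᾱ/3, ᾱα_min/(3γ + ᾱ)}` (`γ` of eq. (3); `|Ω| ≥ 2`). [cite: JerrumEtAl2004, §3 Theorem 4] -/
theorem JerrumEtAl2004_thm_4_logSobolevConst [Nontrivial X] [DecidableEq X] {π : X → ℝ}
    (hπ : ∀ x, 0 < π x) (hπ1 : ∑ x, π x = 1) {P : Matrix X X ℝ} (hP : IsRowStochastic P)
    (hDB : DetailedBalance π P) {blk : X → I} (hblk : Function.Surjective blk) {alphaMin : ℝ}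
    (halphaP : 0 < logSobolevConst (blockMass π blk) (projectionChain π P blk))
    (halphaMin : 0 < alphaMin)
    (hres : ∀ i, ∀ f : X → ℝ, alphaMin * entForm (blockLaw π blk i) f
      ≤ dirichletForm (blockLaw π blk i) (restrictionChain P blk) f) :
    min (logSobolevConst (blockMass π blk) (projectionChain π P blk) / 3)
        (logSobolevConst (blockMass π blk) (projectionChain π P blk) * alphaMin
          / (3 * escapeParameter P blk + logSobolevConst (blockMass π blk) (projectionChain π P blk)))
      ≤ logSobolevConst π P := by
  have hMpos : ∀ i, 0 < blockMass π blk i := blockMass_pos hπ hblk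
  have hproj : ∀ g : I → ℝ, logSobolevConst (blockMass π blk) (projectionChain π P blk)
      * entForm (blockMass π blk) g ≤ dirichletForm (blockMass π blk) (projectionChain π P blk) g :=
    logSobolevConst_mul_entForm_le hMpos (sum_blockMass_eq_one hπ1 blk)
      (projectionChain_nonneg (fun x => (hπ x).le) hP.1 blk)
  exact le_logSobolevConst hπ hπ1
    (fun f => JerrumEtAl2004_thm_4_escapeParameter hπ hP hDB hblk halphaP halphaMin hproj hres f)
    (let ⟨f, hf⟩ := exists_entForm_pos hπ hπ1; ⟨f, hf.ne'⟩)

end Decomposition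

end Literature.Probability.MarkovChains

end
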